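import Literature.Probability.Percolation.PercolationProofs
import Summits.CriticalPhenomena.PercolationContinuityZ3.Theorems.PercNearOneGluingNoHeavyLowerTailKnQuestion8CoefficientwiseHarris
import Summits.CriticalPhenomena.PercolationContinuityZ3.Theorems.PercNearOneGluingNoHeavyLowerTailKnQuestion8CoefficientwiseOffCluster
import HarnessLib

/-!
# Two-function off-cluster cell lemma — the `(1,0)` block of the SERIES step of THEOREM SP (prim-lf-2 gen 25)

Support file (`--supports stmt-CriticalPhenomena-4575`, closed), prover `prim-lf-2` (gen 25).  No definitions, no named facts, no sorries; standard axioms.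
Memo `prim-lf-2/CW-MARTINGALE-gen25.md` §8 (THEOREM SP: the class of rooted graphs satisfying the coefficientwise first rung CW-PA(z) is closed under series and
parallel composition and under hanging decorations; hence it contains all two-terminal series–parallel networks with pendant blocks).

In the series step `G = G₁ ∘_v G₂` the configurations in which `v` is red-connected but not blue-connected to `z` inside `G₂` contribute
`Σ_{ω₁ : v ∉ K₁} (f(K₁) − f̃(K̄₁))(g(K₁) − g̃(K̄₁))` with `f̃(W) = f(W ∪ [v∈W]·B₂) ≥ f` (the blue cluster of `x` is enlarged by the blue `G₂`-cluster of `v`).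
This file proves that such two-function sums are `≥ 0`: gen 23's theorem `Coefficientwise.offCluster_twoColouring_nonneg` (= the case `f̃ = f`, `g̃ = g`)
with the blue-side functions replaced by larger monotone ones.  The proof is gen 23's verbatim (cells of the red cluster of the avoided set; on a cell the free
coordinates are uniform; Harris/FKG for the sublattice; the cell means are signed because `f̃ ≥ f` only helps), routed through the two-function abstract cell
lemmas `twoColouring_cell_nonneg₂` / `twoColouring_cell_nonneg_of_le₂` below.
[cite: KozmaNitzan2024, Questions 8–9 (§5.5 p. 36) (context: first rung of the coefficientwise programme for Question 8)]
-/

namespace Summit.CriticalPhenomena.PercolationContinuityZ3.Theorems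

open Finset Literature.Probability.Percolation

namespace Coefficientwise

section cell
variable {ι : Type*} [Fintype ι] [DecidableEq ι]

/-- Two-function cell lemma (sum form): on a cell `{t | t ∩ B = π}`, if `F, F', G, G'` are monotone and `Σ_cell F t ≤ Σ_cell F' tᶜ`,
`Σ_cell G t ≤ Σ_cell G' tᶜ`, then `0 ≤ Σ_cell (F t − F' tᶜ)(G t − G' tᶜ)`.  (FKG on the sublattice for the monotone `t ↦ F t − F' tᶜ`, `t ↦ G t − G' tᶜ`,
whose cell sums are `≤ 0`.)  [cite: KozmaNitzan2024, §5.5 (context only)] -/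
theorem twoColouring_cell_nonneg₂ (B π : Finset ι) (F F' G G' : Finset ι → ℝ) (hF : Monotone F) (hF' : Monotone F') (hG : Monotone G)
    (hG' : Monotone G')
    (hFc : ∑ t ∈ univ.filter (fun t : Finset ι => t ∩ B = π), F t ≤ ∑ t ∈ univ.filter (fun t : Finset ι => t ∩ B = π), F' tᶜ)
    (hGc : ∑ t ∈ univ.filter (fun t : Finset ι => t ∩ B = π), G t ≤ ∑ t ∈ univ.filter (fun t : Finset ι => t ∩ B = π), G' tᶜ) :
    0 ≤ ∑ t ∈ univ.filter (fun t : Finset ι => t ∩ B = π), (F t - F' tᶜ) * (G t - G' tᶜ) := by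
  set cell := univ.filter (fun t : Finset ι => t ∩ B = π) with hcell
  set Φ : Finset ι → ℝ := fun t => F t - F' tᶜ with hΦ
  set Ψ : Finset ι → ℝ := fun t => G t - G' tᶜ with hΨ
  have hΦm : Monotone Φ := fun s t hst => by
    simp only [hΦ]; linarith [hF hst, hF' (compl_subset_compl.mpr hst)]
  have hΨm : Monotone Ψ := fun s t hst => by
    simp only [hΨ]; linarith [hG hst, hG' (compl_subset_compl.mpr hst)]
  have key := fkg_cell B π Φ Ψ hΦm hΨm
  have hΦs : ∑ t ∈ cell, Φ t ≤ 0 := by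
    simp only [hΦ, Finset.sum_sub_distrib]; linarith
  have hΨs : ∑ t ∈ cell, Ψ t ≤ 0 := by
    simp only [hΨ, Finset.sum_sub_distrib]; linarith
  have hprod : 0 ≤ (∑ t ∈ cell, Φ t) * (∑ t ∈ cell, Ψ t) := mul_nonneg_of_nonpos_of_nonpos hΦs hΨs
  have hcard : (0 : ℝ) ≤ (cell.card : ℝ) := Nat.cast_nonneg _
  by_cases h0 : cell.card = 0
  · have : cell = ∅ := Finset.card_eq_zero.mp h0
    simp [this]
  · have hpos : (0 : ℝ) < (cell.card : ℝ) := by exact_mod_cast Nat.pos_of_ne_zero h0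
    have := le_trans hprod key
    exact nonneg_of_mul_nonneg_right (by linarith) hpos |> fun h => (mul_nonneg_iff_of_pos_left hpos).mp this

/-- Two-function cell lemma (pointwise form): as `twoColouring_cell_nonneg_of_le` with the complement-side functions replaced by larger monotone ones:
`F ≤ F'`, `G ≤ G'` pointwise and `F t ≤ F((B∖π) ∪ (t∖B))`, `G t ≤ G((B∖π) ∪ (t∖B))` on the cell imply `0 ≤ Σ_cell (F t − F' tᶜ)(G t − G' tᶜ)`.
[cite: KozmaNitzan2024, §5.5 (context only)] -/
theorem twoColouring_cell_nonneg_of_le₂ (B π : Finset ι) (hπ : π ⊆ B) (F F' G G' : Finset ι → ℝ) (hF : Monotone F) (hF' : Monotone F')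
    (hG : Monotone G) (hG' : Monotone G') (hFF' : ∀ t, F t ≤ F' t) (hGG' : ∀ t, G t ≤ G' t)
    (hFle : ∀ t : Finset ι, t ∩ B = π → F t ≤ F ((B \ π) ∪ (t \ B)))
    (hGle : ∀ t : Finset ι, t ∩ B = π → G t ≤ G ((B \ π) ∪ (t \ B))) :
    0 ≤ ∑ t ∈ univ.filter (fun t : Finset ι => t ∩ B = π), (F t - F' tᶜ) * (G t - G' tᶜ) := by
  set cell := univ.filter (fun t : Finset ι => t ∩ B = π) with hcell
  have mem_cell : ∀ t : Finset ι, t ∈ cell ↔ t ∩ B = π := fun t => by simp [hcell]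
  set τ : Finset ι → Finset ι := fun t => π ∪ (tᶜ \ B) with hτ
  have facts : ∀ t : Finset ι, t ∩ B = π → ∀ i, (i ∈ π ↔ i ∈ t ∧ i ∈ B) := fun t ht i => by
    rw [← ht]; exact Finset.mem_inter
  have memτ : ∀ t i, i ∈ τ t ↔ i ∈ π ∨ (i ∉ t ∧ i ∉ B) := fun t i => by
    simp only [hτ, Finset.mem_union, Finset.mem_sdiff, Finset.mem_compl]
  have hτcell : ∀ t, t ∩ B = π → τ t ∩ B = π := by
    intro t ht
    ext i
    simp only [Finset.mem_inter, memτ]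
    have h1 := facts t ht i
    have h2 : i ∈ π → i ∈ B := fun h => hπ h
    tauto
  have hττ : ∀ t, t ∩ B = π → τ (τ t) = t := by
    intro t ht
    ext i
    rw [memτ, memτ]
    have h1 := facts t ht i
    have h2 : i ∈ π → i ∈ B := fun h => hπ h
    tauto
  have hflip : ∀ t, t ∩ B = π → tᶜ = (B \ π) ∪ (τ t \ B) := by
    intro t ht
    ext i
    simp only [Finset.mem_compl, Finset.mem_union, Finset.mem_sdiff, memτ]
    have h1 := facts t ht i
    have h2 : i ∈ π → i ∈ B := fun h => hπ h
    tauto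
  have reindex : ∀ H : Finset ι → ℝ, ∑ t ∈ cell, H tᶜ = ∑ t ∈ cell, H ((B \ π) ∪ (t \ B)) := by
    intro H
    refine Finset.sum_bij' (fun t _ => τ t) (fun t _ => τ t) ?_ ?_ ?_ ?_ ?_
    · intro t ht; exact (mem_cell _).mpr (hτcell t ((mem_cell t).mp ht))
    · intro t ht; exact (mem_cell _).mpr (hτcell t ((mem_cell t).mp ht))
    · intro t ht; exact hττ t ((mem_cell t).mp ht)
    · intro t ht; exact hττ t ((mem_cell t).mp ht)
    · intro t ht; rw [hflip t ((mem_cell t).mp ht)]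
  have hFc : ∑ t ∈ cell, F t ≤ ∑ t ∈ cell, F' tᶜ := by
    rw [reindex F']
    exact Finset.sum_le_sum fun t ht => le_trans (hFle t ((mem_cell t).mp ht)) (hFF' _)
  have hGc : ∑ t ∈ cell, G t ≤ ∑ t ∈ cell, G' tᶜ := by
    rw [reindex G']
    exact Finset.sum_le_sum fun t ht => le_trans (hGle t ((mem_cell t).mp ht)) (hGG' _)
  exact twoColouring_cell_nonneg₂ B π F F' G G' hF hF' hG hG' hFc hGc

end cell

variable {ι V : Type*} [Fintype ι] [DecidableEq ι]

open Classical in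
/-- **Two-function off-cluster lemma** (series step of THEOREM SP, block `(1,0)`; memo `prim-lf-2/CW-MARTINGALE-gen25.md` §8): for a finite multigraph
`ends : ι → Sym2 V`, a root `x`, an avoided set `A`, and monotone `f ≤ f̃`, `g ≤ g̃`,
`0 ≤ Σ_{s : A ∩ C_x(s) = ∅} (f(C_x s) − f̃(C_x sᶜ)) (g(C_x s) − g̃(C_x sᶜ))`.
(`f̃ = f`, `g̃ = g` is `Coefficientwise.offCluster_twoColouring_nonneg`.)  [cite: KozmaNitzan2024, Questions 8–9 (§5.5 p. 36) (context)] -/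
theorem offCluster_twoColouring_nonneg₂ (ends : ι → Sym2 V) (x : V) (A : Set V) (f f' g g' : Set V → ℝ)
    (hf : Monotone f) (hf' : Monotone f') (hg : Monotone g) (hg' : Monotone g')
    (hff' : ∀ W, f W ≤ f' W) (hgg' : ∀ W, g W ≤ g' W) :
    0 ≤ ∑ s ∈ univ.filter (fun s : Finset ι => ∀ a ∈ A, a ∉ openCluster (ends '' (↑s : Set ι)) x),
      (f (openCluster (ends '' (↑s : Set ι)) x) - f' (openCluster (ends '' (↑(sᶜ) : Set ι)) x)) *
        (g (openCluster (ends '' (↑s : Set ι)) x) - g' (openCluster (ends '' (↑(sᶜ) : Set ι)) x)) := by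
  -- notation
  set K : Finset ι → Set V := fun s => openCluster (ends '' (↑s : Set ι)) x with hK
  set F : Finset ι → ℝ := fun s => f (K s) with hF
  set G : Finset ι → ℝ := fun s => g (K s) with hG
  set F' : Finset ι → ℝ := fun s => f' (K s) with hF'
  set G' : Finset ι → ℝ := fun s => g' (K s) with hG'
  set D : Finset (Finset ι) := univ.filter (fun s : Finset ι => ∀ a ∈ A, a ∉ openCluster (ends '' (↑s : Set ι)) x) with hD
  change 0 ≤ ∑ s ∈ D, (F s - F' sᶜ) * (G s - G' sᶜ)
  have hKmono : ∀ {s t : Finset ι}, s ⊆ t → K s ⊆ K t := fun hst => openCluster_image_mono ends hst x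
  have hFm : Monotone F := fun s t hst => hf (hKmono hst)
  have hGm : Monotone G := fun s t hst => hg (hKmono hst)
  have hF'm : Monotone F' := fun s t hst => hf' (hKmono hst)
  have hG'm : Monotone G' := fun s t hst => hg' (hKmono hst)
  -- the red cluster of the set `A`, the edges at a vertex set, and the cell key
  set R : Finset ι → Set V := fun s => {y | ∃ a ∈ A, y ∈ openCluster (ends '' (↑s : Set ι)) a} with hR
  set I : Set V → Finset ι := fun S => univ.filter (fun i : ι => ∃ v ∈ S, v ∈ ends i) with hI
  set key : Finset ι → Set V × Finset ι := fun s => (R s, s ∩ I (R s)) with hkey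
  -- basic facts about `R`
  have R_closed : ∀ (s : Finset ι) {u w : V}, u ∈ R s → (openGraph (ends '' (↑s : Set ι))).Adj u w → w ∈ R s := by
    intro s u w hu hadj
    obtain ⟨a, haA, hau⟩ := hu
    exact ⟨a, haA, SimpleGraph.Reachable.trans hau hadj.reachable⟩
  have mem_I : ∀ (S : Set V) (i : ι) (v : V), v ∈ S → v ∈ ends i → i ∈ I S := by
    intro S i v hv hvi
    simp only [hI, Finset.mem_filter, Finset.mem_univ, true_and]
    exact ⟨v, hv, hvi⟩
  have A_sub_R : ∀ (s : Finset ι), ∀ a ∈ A, a ∈ R s := fun s a ha => ⟨a, ha, mem_openCluster_self _ a⟩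
  -- (L3) locality: a configuration agreeing with `s₀` on the edges at `R s₀` has the same red cluster of `A`
  have locality : ∀ s₀ t : Finset ι, t ∩ I (R s₀) = s₀ ∩ I (R s₀) → R t = R s₀ := by
    intro s₀ t ht
    have agree : ∀ i, i ∈ I (R s₀) → (i ∈ t ↔ i ∈ s₀) := by
      intro i hi
      have := congrArg (fun u : Finset ι => i ∈ u) ht
      simp only [Finset.mem_inter, hi, and_true, eq_iff_iff] at this
      exact this
    -- transfer s₀-walks to t-walks inside `R s₀`
    have h1 : ∀ u ∈ R s₀, ∀ w, (openGraph (ends '' (↑s₀ : Set ι))).Adj u w →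
        (openGraph (ends '' (↑t : Set ι))).Adj u w ∧ w ∈ R s₀ := by
      intro u hu w hadj
      refine ⟨?_, R_closed s₀ hu hadj⟩
      rw [openGraph_image_adj] at hadj ⊢
      obtain ⟨⟨i, his, hi⟩, hne⟩ := hadj
      have hiI : i ∈ I (R s₀) := mem_I _ i u hu (by rw [hi]; exact Sym2.mem_mk_left u w)
      exact ⟨⟨i, (agree i hiI).mpr his, hi⟩, hne⟩
    -- transfer t-walks to s₀-walks inside `R s₀`
    have h2 : ∀ u ∈ R s₀, ∀ w, (openGraph (ends '' (↑t : Set ι))).Adj u w →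
        (openGraph (ends '' (↑s₀ : Set ι))).Adj u w ∧ w ∈ R s₀ := by
      intro u hu w hadj
      have hadj' : (openGraph (ends '' (↑s₀ : Set ι))).Adj u w := by
        rw [openGraph_image_adj] at hadj ⊢
        obtain ⟨⟨i, hit, hi⟩, hne⟩ := hadj
        have hiI : i ∈ I (R s₀) := mem_I _ i u hu (by rw [hi]; exact Sym2.mem_mk_left u w)
        exact ⟨⟨i, (agree i hiI).mp hit, hi⟩, hne⟩
      exact ⟨hadj', R_closed s₀ hu hadj'⟩
    ext y
    constructor
    · rintro ⟨a, haA, hay⟩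
      obtain ⟨p⟩ := hay
      exact ((reachable_transfer (R s₀) h2 p) (A_sub_R s₀ a haA)).2
    · rintro ⟨a, haA, hay⟩
      obtain ⟨p⟩ := hay
      exact ⟨a, haA, ((reachable_transfer (R s₀) h1 p) (A_sub_R s₀ a haA)).1⟩
  -- split the sum over `D` along the fibres of `key`
  rw [← Finset.sum_fiberwise_of_maps_to (s := D) (t := D.image key) (g := key)
    (fun s hs => Finset.mem_image_of_mem key hs)]
  refine Finset.sum_nonneg fun k hk => ?_
  obtain ⟨s₀, hs₀D, rfl⟩ := Finset.mem_image.mp hk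
  have hs₀ : ∀ a ∈ A, a ∉ K s₀ := by
    have := (Finset.mem_filter.mp hs₀D).2
    simpa [hK] using this
  -- abbreviations for the frozen data of the cell of `s₀`
  set S₀ : Set V := R s₀ with hS₀
  set B : Finset ι := I S₀ with hB
  set π : Finset ι := s₀ ∩ B with hπ
  have hxS₀ : x ∉ S₀ := by
    rintro ⟨a, haA, hax⟩
    exact hs₀ a haA (SimpleGraph.Reachable.symm hax)
  -- (L4) the fibre of `key s₀` in `D` is exactly the cell `{t | t ∩ B = π}`
  have fiber_eq : D.filter (fun t => key t = key s₀) = univ.filter (fun t : Finset ι => t ∩ B = π) := by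
    ext t
    simp only [Finset.mem_filter, Finset.mem_univ, true_and]
    constructor
    · rintro ⟨_, hkt⟩
      have h1 : R t = S₀ := (Prod.ext_iff.mp hkt).1
      have h2 : t ∩ I (R t) = s₀ ∩ I (R s₀) := (Prod.ext_iff.mp hkt).2
      rw [h1] at h2
      exact h2
    · intro ht
      have hRt : R t = S₀ := locality s₀ t ht
      refine ⟨?_, ?_⟩
      · rw [hD, Finset.mem_filter]
        refine ⟨Finset.mem_univ _, fun a haA hax => ?_⟩
        have hxRt : x ∈ R t := ⟨a, haA, SimpleGraph.Reachable.symm hax⟩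
        rw [hRt] at hxRt
        exact hxS₀ hxRt
      · change (R t, t ∩ I (R t)) = (R s₀, s₀ ∩ I (R s₀))
        rw [hRt]
        exact Prod.ext rfl ht
  rw [fiber_eq]
  -- (L5) on the cell, the red cluster of `x` uses no edge at `S₀`
  have offcluster : ∀ t : Finset ι, t ∩ B = π → K t ⊆ K ((B \ π) ∪ (t \ B)) := by
    intro t ht
    have agree : ∀ i, i ∈ B → (i ∈ t ↔ i ∈ s₀) := by
      intro i hi
      have := congrArg (fun u : Finset ι => i ∈ u) ht
      simp only [hπ, Finset.mem_inter, hi, and_true, eq_iff_iff] at this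
      exact this
    have htr : ∀ u ∈ S₀ᶜ, ∀ w, (openGraph (ends '' (↑t : Set ι))).Adj u w →
        (openGraph (ends '' (↑(t \ B) : Set ι))).Adj u w ∧ w ∈ S₀ᶜ := by
      intro u hu w hadj
      rw [openGraph_image_adj] at hadj
      obtain ⟨⟨i, hit, hi⟩, hne⟩ := hadj
      -- the edge `i` is not at `S₀`
      have hiB : i ∉ B := by
        intro hiB
        have his₀ : i ∈ s₀ := (agree i hiB).mp hit
        have hiB' := hiB
        simp only [hB, hI, Finset.mem_filter, Finset.mem_univ, true_and] at hiB'
        obtain ⟨v, hvS, hvi⟩ := hiB'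
        rw [hi, Sym2.mem_iff] at hvi
        rcases hvi with rfl | rfl
        · exact hu hvS
        · -- `w ∈ S₀` and the red edge `i ∈ s₀` joins `w` to `u`, so `u ∈ S₀`
          have hadj₀ : (openGraph (ends '' (↑s₀ : Set ι))).Adj v u := by
            rw [openGraph_image_adj]
            exact ⟨⟨i, his₀, by rw [hi, Sym2.eq_swap]⟩, hne.symm⟩
          exact hu (R_closed s₀ hvS hadj₀)
      have hwS : w ∈ S₀ᶜ := by
        intro hwS
        exact hiB (mem_I S₀ i w hwS (by rw [hi]; exact Sym2.mem_mk_right u w))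
      refine ⟨?_, hwS⟩
      rw [openGraph_image_adj]
      exact ⟨⟨i, Finset.mem_sdiff.mpr ⟨hit, hiB⟩, hi⟩, hne⟩
    intro y hy
    obtain ⟨p⟩ := hy
    have hreach := ((reachable_transfer S₀ᶜ htr p) hxS₀).1
    exact hKmono Finset.subset_union_right hreach
  refine twoColouring_cell_nonneg_of_le₂ B π Finset.inter_subset_right F F' G G' hFm hF'm hGm hG'm (fun t => hff' _) (fun t => hgg' _) ?_ ?_
  · intro t ht; exact hf (offcluster t ht)
  · intro t ht; exact hg (offcluster t ht)


end Coefficientwise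

end Summit.CriticalPhenomena.PercolationContinuityZ3.Theorems
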